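import Mathlib.Analysis.InnerProductSpace.Calculus
import Mathlib.Analysis.Normed.Module.Ball.Homeomorph
import Mathlib.Geometry.Manifold.ContMDiff.Atlas
import Mathlib.Geometry.Manifold.ContMDiff.NormedSpace
import Mathlib.Geometry.Manifold.MFDeriv.Basic
import Mathlib.Geometry.Manifold.MFDeriv.SpecificFunctions
import Mathlib.Geometry.Manifold.SmoothApprox
import Mathlib.Geometry.Manifold.PartitionOfUnity
import Mathlib.Topology.ContinuousMap.Compact
import Mathlib.Topology.Homotopy.Basic
import Literature.Topology.FourManifolds.ChartFieldFlow
import HarnessLib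

/-!
# Chart moves: perturbing a map into a manifold inside one full chart of the target

Topic `Literature/Topology/FourManifolds` (infrastructure for the fact seat of
`Literature.Topology.FourManifolds.HomotopySphere.exists_highlyConnected_of_mem_signatureSet`,
brick B8-E: Whitney's approximation and easy embedding theorems for maps of a compact manifold
INTO A NON-COMPACT manifold, in a prescribed homotopy class).  The classical device (H. Whitney,
*Differentiable manifolds*, Ann. of Math. 37 (1936), §II; M. W. Hirsch, *Differential Topology*
(1976), Ch. 2 §2, proof of Thm. 2.6; J. Milnor, *Lectures on the h-cobordism theorem* (1965),
Lemma 6.11): modify `g : M → X` only over the preimage of one coordinate domain of `X`, by a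
displacement in coordinates weighted by a bump function of `M`.

We use **full charts** of the target — coordinate maps `ψ : U ≃ E` onto the WHOLE model vector
space (a chart ball re-identified with `E` by Mathlib's `OpenPartialHomeomorph.univBall`) — so
that the move `x ↦ χ (ψ (g x) + β x • P x)` (`χ = ψ⁻¹`) is defined for every displacement field
`P : M → E` with no smallness condition; smallness enters only to preserve finitely many
constraints "`g` maps the compact `Cᵢ` into the open `Vᵢ`", which cut out an open neighbourhood of
`P = 0` in `C(M, E)` because the move depends continuously on `(P, x)`.

* `FullChart E X` — the subtype of Mathlib `OpenPartialHomeomorph X E` satisfying the tree's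
  `IsFullChart` (`ChartFieldFlow.lean`: target `= univ`, smooth, smooth inverse);
  `exists_fullChart` — full charts about every point of a manifold charted on an inner product
  space `E` (model `𝓘(ℝ, E)`), a chart ball re-identified with `E` by
  `OpenPartialHomeomorph.univBall`.
* `FullChart.move c g β P` — the chart move; `move_zero` (`P = 0` gives `g` back),
  `move_of_eq_zero` (unchanged where `β = 0`), `continuous_move_param` (joint continuity in a
  parameter of `P`), `moveFamily` (the continuous map `C(M, E) → C(M, X)`), `homotopic_move`
  (`g ≃ move` through `t • P`), `exists_pos_forall_mapsTo_move` (small displacements keep finitely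
  many compact-into-open constraints), `contMDiff_move` (smooth data give a smooth move).
* `exists_contMDiff_homotopic_of_chartMoves` — **Whitney approximation in a homotopy class for
  a non-compact target** (Hirsch 1976, Ch. 2 Thm. 2.6; Lee 2013, Thm. 6.26): every continuous map
  from a compact manifold `M` into `X` is homotopic to a `C^∞` map (finitely many chart moves with
  displacement `s - ψ ∘ g`, `s` a smooth approximation of the cut-off coordinate function given by
  Mathlib's `Continuous.exists_contMDiff_approx`).

Relation to the tree: the one-chart smoothing move `FullChart.exists_move_contMDiffOn` and the
finite induction of `exists_contMDiff_homotopic_of_chartMoves` parallel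
`Literature.Topology.FourManifolds.exists_smoothing_step` /
`Literature.Topology.FourManifolds.exists_contMDiffOn_of_isCompact` of
`HomotopySmoothingChartwise.lean` (relative smoothing into a non-compact target modelled on `ℝⁿ`,
constraints carried along); the new deliverables here are the HOMOTOPY to the original map
(`FullChart.homotopic_move`, needed to stay in a prescribed homotopy class), the displacement as a
continuous family `C(M, E) → C(M, X)` (reused by the generic embedding moves of
`WhitneyEmbeddingInClass.lean`), and the general model space `E`.

Everything is proved; no named facts are introduced.

## References

* H. Whitney, *Differentiable manifolds*, Ann. of Math. (2) 37 (1936), 645–680, §II. [Whitney1936]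
* M. W. Hirsch, *Differential Topology*, GTM 33 (1976), Ch. 2 §2, Thm. 2.6. [HirschDT1976]
* J. M. Lee, *Introduction to Smooth Manifolds*, 2nd ed. (2013), Thm. 6.26. [LeeSmoothManifolds2013]
* J. Milnor, *Lectures on the h-cobordism theorem* (1965), Lemma 6.11. [MilnorHCobordism1965]
-/

open scoped Manifold ContDiff Topology
open Set Function Metric Filter

noncomputable section

namespace Literature.Topology.FourManifolds

/-! ### Full charts -/

section FullChart

variable (E : Type*) [NormedAddCommGroup E] [InnerProductSpace ℝ E]
  (X : Type*) [TopologicalSpace X] [ChartedSpace E X]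

/-- A **full chart** of a manifold `X` charted on the vector space `E`: a Mathlib
`OpenPartialHomeomorph X E` which is onto ALL of `E`, `C^∞` on its source and with `C^∞` inverse —
the tree's `IsFullChart` (`ChartFieldFlow.lean`), packaged as a subtype so that charts can be
chosen and carried as data (`exists_fullChart`). [folklore] -/
abbrev FullChart := {Φ : OpenPartialHomeomorph X E // IsFullChart Φ}

variable {E X}

namespace FullChart

variable (c : FullChart E X)

/-- The inverse chart is injective (the chart is a left inverse on all of `E`). [folklore] -/
theorem injective_symm : Injective c.1.symm :=
  Function.LeftInverse.injective (g := c.1) fun e => c.2.apply_symm e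

/-- The differential of the inverse chart is injective (it has the left inverse `dΦ`).
[folklore] -/
theorem injective_mfderiv_symm (e : E) : Injective (mfderiv 𝓘(ℝ, E) 𝓘(ℝ, E) c.1.symm e) := by
  have hχ : MDifferentiableAt 𝓘(ℝ, E) 𝓘(ℝ, E) c.1.symm e :=
    c.2.contMDiff_symm.mdifferentiableAt (by simp)
  have hψ : MDifferentiableAt 𝓘(ℝ, E) 𝓘(ℝ, E) c.1 (c.1.symm e) :=
    (c.2.contMDiffAt (c.2.symm_mem_source e)).mdifferentiableAt (by simp)
  have hcomp : mfderiv 𝓘(ℝ, E) 𝓘(ℝ, E) (c.1 ∘ c.1.symm) e =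
      (mfderiv 𝓘(ℝ, E) 𝓘(ℝ, E) c.1 (c.1.symm e)).comp (mfderiv 𝓘(ℝ, E) 𝓘(ℝ, E) c.1.symm e) :=
    mfderiv_comp e hψ hχ
  have hid : (c.1 : X → E) ∘ c.1.symm = id := funext fun e => c.2.apply_symm e
  rw [hid, mfderiv_id] at hcomp
  intro v w hvw
  have := congrArg (mfderiv 𝓘(ℝ, E) 𝓘(ℝ, E) c.1 (c.1.symm e)) hvw
  rw [← ContinuousLinearMap.comp_apply, ← ContinuousLinearMap.comp_apply, ← hcomp] at this
  exact this

end FullChart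

variable [IsManifold 𝓘(ℝ, E) ∞ X]

/-- **Every point of a manifold charted on an inner product space lies in a full chart** (a
chart ball about the point, re-identified with `E` by the diffeomorphism
`OpenPartialHomeomorph.univBall`; the existence statement complementing `IsFullChart`).
[folklore] -/
theorem exists_fullChart (p : X) : ∃ c : FullChart E X, p ∈ c.1.source := by
  set φ := chartAt E p with hφ
  have hct : φ.target ∈ 𝓝 (φ p) := φ.open_target.mem_nhds (φ.map_source (mem_chart_source E p))
  obtain ⟨r, hr, hball⟩ := Metric.mem_nhds_iff.1 hct
  set u := OpenPartialHomeomorph.univBall (φ p) r with hu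
  have hut : u.target = ball (φ p) r := OpenPartialHomeomorph.univBall_target _ hr
  have hus : ∀ e, e ∈ u.source := fun e => by
    rw [hu, OpenPartialHomeomorph.univBall_source]; trivial
  have hue : ∀ e, u e ∈ ball (φ p) r := fun e => by rw [← hut]; exact u.map_source (hus e)
  set Φ : OpenPartialHomeomorph X E := φ.trans u.symm with hΦ
  have hΦsource : Φ.source = φ.source ∩ φ ⁻¹' ball (φ p) r := by
    rw [hΦ, OpenPartialHomeomorph.trans_source, OpenPartialHomeomorph.symm_source, hut]
  have hΦtarget : Φ.target = univ := by
    rw [hΦ, OpenPartialHomeomorph.trans_target, OpenPartialHomeomorph.symm_target,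
      OpenPartialHomeomorph.univBall_source,
      univ_inter, eq_univ_iff_forall]
    intro e
    show u.symm.symm e ∈ φ.target
    rw [OpenPartialHomeomorph.symm_symm]
    exact hball (hue e)
  refine ⟨⟨Φ, ⟨hΦtarget, ?_, ?_⟩⟩, ?_⟩
  · -- smooth on the source
    have h1 : ContMDiffOn 𝓘(ℝ, E) 𝓘(ℝ, E) ∞ φ φ.source := contMDiffOn_chart
    have h2 : ContMDiffOn 𝓘(ℝ, E) 𝓘(ℝ, E) ∞ u.symm (ball (φ p) r) :=
      (OpenPartialHomeomorph.contDiffOn_univBall_symm (c := φ p) (r := r)).contMDiffOn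
    rw [hΦsource]
    exact h2.comp (h1.mono inter_subset_left) fun x hx => hx.2
  · -- smooth inverse
    have h1 : ContMDiff 𝓘(ℝ, E) 𝓘(ℝ, E) ∞ u :=
      (OpenPartialHomeomorph.contDiff_univBall (c := φ p) (r := r)).contMDiff
    have h2 : ContMDiffOn 𝓘(ℝ, E) 𝓘(ℝ, E) ∞ φ.symm φ.target := contMDiffOn_chart_symm
    exact h2.comp_contMDiff h1 fun e => hball (hue e)
  · show p ∈ Φ.source
    rw [hΦsource]
    exact ⟨mem_chart_source E p, mem_ball_self hr⟩

end FullChart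

/-! ### The chart move -/

section Move

variable {E : Type*} [NormedAddCommGroup E] [InnerProductSpace ℝ E]
  {X : Type*} [TopologicalSpace X] [ChartedSpace E X]
  {M : Type*}

namespace FullChart

variable (c : FullChart E X)

open Classical in
/-- **The chart move** of `g : M → X` in the full chart `c` with weight `β : M → ℝ` and
displacement field `P : M → E`: `x ↦ χ (ψ (g x) + β x • P x)` where `g x` lies in the coordinate
domain, `g x` elsewhere (Whitney 1936 §II; Hirsch 1976, Ch. 2 §2; Milnor 1965, Lemma 6.11).
[folklore] -/
def move (g : M → X) (β : M → ℝ) (P : M → E) (x : M) : X :=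
  if g x ∈ c.1.source then c.1.symm (c.1 (g x) + β x • P x) else g x

variable {c} {g : M → X} {β : M → ℝ} {P : M → E}

/-- The move over the coordinate domain. [folklore] -/
theorem move_of_mem {x : M} (hx : g x ∈ c.1.source) : c.move g β P x = c.1.symm (c.1 (g x) + β x • P x) := by
  simp only [move, if_pos hx]

/-- The move off the coordinate domain. [folklore] -/
theorem move_of_not_mem {x : M} (hx : g x ∉ c.1.source) : c.move g β P x = g x := by
  simp only [move, if_neg hx]

/-- Where the weight vanishes the move does not move. [folklore] -/
theorem move_of_eq_zero {x : M} (hx : β x = 0) : c.move g β P x = g x := by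
  by_cases h : g x ∈ c.1.source
  · rw [move_of_mem h, hx, zero_smul, add_zero, c.1.left_inv h]
  · exact move_of_not_mem h

/-- The zero displacement gives the map back. [folklore] -/
theorem move_zero (g : M → X) (β : M → ℝ) : c.move g β (0 : M → E) = g := by
  funext x
  by_cases h : g x ∈ c.1.source
  · rw [move_of_mem h, Pi.zero_apply, smul_zero, add_zero, c.1.left_inv h]
  · exact move_of_not_mem h

/-- The zero displacement gives the map back (lambda form). [folklore] -/
theorem move_zero' (g : M → X) (β : M → ℝ) : c.move g β (fun _ => (0 : E)) = g :=
  move_zero g β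

/-- The move keeps points of the coordinate domain in it. [folklore] -/
theorem move_mem {x : M} (hx : g x ∈ c.1.source) : c.move g β P x ∈ c.1.source := by
  rw [move_of_mem hx]; exact c.2.symm_mem_source _

/-- A moved point lies in the coordinate domain iff the original point does. [folklore] -/
theorem move_mem_iff {x : M} : c.move g β P x ∈ c.1.source ↔ g x ∈ c.1.source := by
  by_cases h : g x ∈ c.1.source
  · exact ⟨fun _ => h, fun _ => move_mem h⟩
  · rw [move_of_not_mem h]

variable [TopologicalSpace M]

/-- Off the support of the weight the move agrees with the map near the point. [folklore] -/
theorem move_eventuallyEq_of_notMem_tsupport {x : M} (hx : x ∉ tsupport β) (P : M → E) :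
    (fun y => c.move g β P y) =ᶠ[𝓝 x] g := by
  filter_upwards [notMem_tsupport_iff_eventuallyEq.1 hx] with y hy
  exact move_of_eq_zero hy

/-- Over the coordinate domain the move is the displayed composite near the point. [folklore] -/
theorem move_eventuallyEq_of_mem (hg : Continuous g) {x : M} (hx : g x ∈ c.1.source) (β : M → ℝ)
    (P : M → E) : (c.move g β P) =ᶠ[𝓝 x] fun y => c.1.symm (c.1 (g y) + β y • P y) := by
  filter_upwards [(c.1.open_source.preimage hg).mem_nhds hx] with y hy
  exact move_of_mem hy

/-- **Joint continuity of the chart move in a parameter of the displacement.** If `g` is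
continuous, the weight is continuous with `tsupport β ⊆ g ⁻¹' U`, and the displacement depends
continuously on a parameter `τ` and the point, then `(τ, x) ↦ move g β (P τ) x` is continuous: over
`g ⁻¹' U` it is a composite of continuous maps, and off `tsupport β` it is `g`. [folklore] -/
theorem continuous_move_param {T : Type*} [TopologicalSpace T] (hg : Continuous g)
    (hβ : Continuous β) (hsupp : tsupport β ⊆ g ⁻¹' c.1.source) {Φ : T → M → E}
    (hΦ : Continuous fun q : T × M => Φ q.1 q.2) :
    Continuous fun q : T × M => c.move g β (Φ q.1) q.2 := by
  refine continuous_iff_continuousAt.2 fun q => ?_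
  by_cases hq : g q.2 ∈ c.1.source
  · -- over the coordinate domain
    have hO : IsOpen {q : T × M | g q.2 ∈ c.1.source} := (c.1.open_source.preimage hg).preimage continuous_snd
    have hform : ∀ q' ∈ {q : T × M | g q.2 ∈ c.1.source},
        c.move g β (Φ q'.1) q'.2 = c.1.symm (c.1 (g q'.2) + β q'.2 • Φ q'.1 q'.2) :=
      fun q' hq' => move_of_mem hq'
    have hcont : ContinuousOn (fun q' : T × M => c.1.symm (c.1 (g q'.2) + β q'.2 • Φ q'.1 q'.2))
        {q : T × M | g q.2 ∈ c.1.source} := by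
      refine c.2.contMDiff_symm.continuous.comp_continuousOn ?_
      refine ContinuousOn.add ?_ ?_
      · exact (c.1.continuousOn.comp hg.continuousOn fun q' hq' => hq').comp
          continuous_snd.continuousOn fun q' hq' => hq'
      · exact ((hβ.comp continuous_snd).smul hΦ).continuousOn
    have h1 : ContinuousAt (fun q' : T × M => c.1.symm (c.1 (g q'.2) + β q'.2 • Φ q'.1 q'.2)) q :=
      hcont.continuousAt (hO.mem_nhds hq)
    refine h1.congr ?_
    filter_upwards [hO.mem_nhds hq] with q' hq'
    exact (hform q' hq').symm
  · -- off the support of the weight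
    have hx : q.2 ∉ tsupport β := fun h => hq (hsupp h)
    obtain ⟨N, hN, hNβ⟩ : ∃ N ∈ 𝓝 q.2, ∀ y ∈ N, β y = 0 := by
      have := notMem_tsupport_iff_eventuallyEq.1 hx
      exact ⟨{y | β y = 0}, this, fun y hy => hy⟩
    have h1 : ContinuousAt (fun q' : T × M => g q'.2) q := (hg.comp continuous_snd).continuousAt
    refine h1.congr ?_
    filter_upwards [continuous_snd.continuousAt.preimage_mem_nhds hN] with q' hq'
    exact (move_of_eq_zero (hNβ _ hq')).symm

/-- The chart move of a continuous map by a continuous displacement is continuous. [folklore] -/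
theorem continuous_move (hg : Continuous g) (hβ : Continuous β) (hsupp : tsupport β ⊆ g ⁻¹' c.1.source)
    (hP : Continuous P) : Continuous (c.move g β P) := by
  have := continuous_move_param (T := Unit) hg hβ hsupp (Φ := fun _ => P) (hP.comp continuous_snd)
  exact this.comp (Continuous.prodMk_right ())

end FullChart

end Move

/-! ### The move as a continuous family, homotopies, constraints -/

section Family

variable {E : Type*} [NormedAddCommGroup E] [InnerProductSpace ℝ E]
  {X : Type*} [TopologicalSpace X] [ChartedSpace E X]
  {M : Type*} [TopologicalSpace M] [LocallyCompactSpace M]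

namespace FullChart

variable (c : FullChart E X) {g : M → X} {β : M → ℝ}

/-- **The chart move as a continuous map `C(M, E) → C(M, X)`** (compact-open topologies).
[folklore] -/
def moveFamily (hg : Continuous g) (hβ : Continuous β) (hsupp : tsupport β ⊆ g ⁻¹' c.1.source) :
    C(C(M, E), C(M, X)) :=
  ContinuousMap.curry
    ⟨fun q : C(M, E) × M => c.move g β q.1 q.2,
      continuous_move_param hg hβ hsupp (Φ := fun P : C(M, E) => (P : M → E))
        continuous_eval⟩

/-- Evaluation of the move family. [folklore] -/
@[simp] theorem moveFamily_apply (hg : Continuous g) (hβ : Continuous β)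
    (hsupp : tsupport β ⊆ g ⁻¹' c.1.source) (P : C(M, E)) (x : M) :
    c.moveFamily hg hβ hsupp P x = c.move g β P x := rfl

/-- The move family at the zero displacement is the map. [folklore] -/
theorem moveFamily_zero (hg : Continuous g) (hβ : Continuous β)
    (hsupp : tsupport β ⊆ g ⁻¹' c.1.source) : c.moveFamily hg hβ hsupp 0 = ⟨g, hg⟩ := by
  ext x
  simp only [moveFamily_apply, ContinuousMap.coe_zero, move_zero, ContinuousMap.coe_mk]

/-- **The chart move is homotopic to the map**, through the moves by `t • P`. [folklore] -/
theorem homotopic_move (hg : Continuous g) (hβ : Continuous β) (hsupp : tsupport β ⊆ g ⁻¹' c.1.source)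
    (P : C(M, E)) : (⟨g, hg⟩ : C(M, X)).Homotopic (c.moveFamily hg hβ hsupp P) := by
  have hΦ : Continuous fun q : unitInterval × M => ((q.1 : ℝ) • P) q.2 := by
    simp only [ContinuousMap.coe_smul, Pi.smul_apply]
    exact (continuous_subtype_val.comp continuous_fst).smul (P.continuous.comp continuous_snd)
  refine ⟨{ toFun := fun q : unitInterval × M => c.move g β ((q.1 : ℝ) • P) q.2
            continuous_toFun := continuous_move_param hg hβ hsupp
              (Φ := fun t : unitInterval => (((t : ℝ) • P : C(M, E)) : M → E)) hΦ
            map_zero_left := fun x => ?_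
            map_one_left := fun x => ?_ }⟩
  · show c.move g β (((0 : ℝ) • P : C(M, E)) : M → E) x = g x
    rw [zero_smul, ContinuousMap.coe_zero, move_zero]
  · show c.move g β (((1 : ℝ) • P : C(M, E)) : M → E) x = c.move g β P x
    rw [one_smul]

/-- **Small displacements keep finitely many compact-into-open constraints.** If `g` maps the
compact sets `C i` into the open sets `V i` (finitely many `i`) and `M` is compact, then so does
every chart move of `g` by a displacement of small enough sup norm. [folklore] -/
theorem exists_pos_forall_mapsTo_move [CompactSpace M] (hg : Continuous g) (hβ : Continuous β)
    (hsupp : tsupport β ⊆ g ⁻¹' c.1.source) {ι : Type*} [Finite ι] {C : ι → Set M} {V : ι → Set X}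
    (hC : ∀ i, IsCompact (C i)) (hV : ∀ i, IsOpen (V i)) (hCV : ∀ i, MapsTo g (C i) (V i)) :
    ∃ δ > 0, ∀ P : C(M, E), ‖P‖ < δ → ∀ i, MapsTo (c.move g β P) (C i) (V i) := by
  set A : Set C(M, E) := {P | ∀ i, MapsTo (c.moveFamily hg hβ hsupp P) (C i) (V i)} with hA
  have hAo : IsOpen A := by
    have : A = ⋂ i, c.moveFamily hg hβ hsupp ⁻¹' {f : C(M, X) | MapsTo f (C i) (V i)} := by
      ext P; simp [hA]
    rw [this]
    exact isOpen_iInter_of_finite fun i =>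
      (ContinuousMap.isOpen_setOf_mapsTo (hC i) (hV i)).preimage (c.moveFamily hg hβ hsupp).continuous
  have h0 : (0 : C(M, E)) ∈ A := fun i => by
    rw [moveFamily_zero]; exact hCV i
  obtain ⟨δ, hδ, hball⟩ := Metric.isOpen_iff.1 hAo 0 h0
  refine ⟨δ, hδ, fun P hP i => ?_⟩
  have : P ∈ A := hball (by rwa [mem_ball, dist_zero_right])
  exact this i

end FullChart

end Family

/-! ### Smoothness of the move -/

section Smooth

variable {E : Type*} [NormedAddCommGroup E] [InnerProductSpace ℝ E]
  {X : Type*} [TopologicalSpace X] [ChartedSpace E X] [IsManifold 𝓘(ℝ, E) ∞ X]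
  {EM : Type*} [NormedAddCommGroup EM] [NormedSpace ℝ EM] {HM : Type*} [TopologicalSpace HM]
  {IM : ModelWithCorners ℝ EM HM} {M : Type*} [TopologicalSpace M] [ChartedSpace HM M]

namespace FullChart

variable (c : FullChart E X) {g : M → X} {β : M → ℝ} {P : M → E}

omit [IsManifold 𝓘(ℝ, E) ∞ X] in
/-- **Smooth data give a smooth move**: over `g ⁻¹' U` the move is `χ ∘ (ψ ∘ g + β • P)`, and off
`tsupport β` it is `g`. More generally, if `g` is `C^∞` on an open set `O`, so is the move.
[folklore] -/
theorem contMDiffOn_move {O : Set M} (hO : IsOpen O) (hg : Continuous g)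
    (hgO : ContMDiffOn IM 𝓘(ℝ, E) ∞ g O) (hβ : ContMDiff IM 𝓘(ℝ) ∞ β)
    (hsupp : tsupport β ⊆ g ⁻¹' c.1.source) (hP : ContMDiffOn IM 𝓘(ℝ, E) ∞ P O) :
    ContMDiffOn IM 𝓘(ℝ, E) ∞ (c.move g β P) O := by
  intro x hx
  by_cases hxU : g x ∈ c.1.source
  · -- over the coordinate domain
    set O' := O ∩ g ⁻¹' c.1.source with hO'
    have hO'o : IsOpen O' := hO.inter (c.1.open_source.preimage hg)
    have hxO' : x ∈ O' := ⟨hx, hxU⟩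
    have h1 : ContMDiffOn IM 𝓘(ℝ, E) ∞ (fun y => c.1.symm (c.1 (g y) + β y • P y)) O' := by
      refine c.2.contMDiff_symm.comp_contMDiffOn ?_
      refine ContMDiffOn.add ?_ ?_
      · exact c.2.contMDiffOn.comp (hgO.mono inter_subset_left) fun y hy => hy.2
      · exact (hβ.contMDiffOn.mono (subset_univ _)).smul (hP.mono inter_subset_left)
    have h2 : ContMDiffAt IM 𝓘(ℝ, E) ∞ (fun y => c.1.symm (c.1 (g y) + β y • P y)) x :=
      h1.contMDiffAt (hO'o.mem_nhds hxO')
    refine (h2.congr_of_eventuallyEq ?_).contMDiffWithinAt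
    filter_upwards [hO'o.mem_nhds hxO'] with y hy
    exact move_of_mem hy.2
  · have hxs : x ∉ tsupport β := fun h => hxU (hsupp h)
    have h2 : ContMDiffAt IM 𝓘(ℝ, E) ∞ g x := hgO.contMDiffAt (hO.mem_nhds hx)
    exact (h2.congr_of_eventuallyEq (move_eventuallyEq_of_notMem_tsupport hxs P)).contMDiffWithinAt

omit [IsManifold 𝓘(ℝ, E) ∞ X] in
/-- Smooth data give a smooth move. [folklore] -/
theorem contMDiff_move (hg : ContMDiff IM 𝓘(ℝ, E) ∞ g) (hβ : ContMDiff IM 𝓘(ℝ) ∞ β)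
    (hsupp : tsupport β ⊆ g ⁻¹' c.1.source) (hP : ContMDiff IM 𝓘(ℝ, E) ∞ P) :
    ContMDiff IM 𝓘(ℝ, E) ∞ (c.move g β P) := by
  have := c.contMDiffOn_move isOpen_univ hg.continuous hg.contMDiffOn hβ hsupp hP.contMDiffOn
  exact contMDiffOn_univ.1 this

end FullChart

end Smooth

/-! ### Whitney approximation in a homotopy class, non-compact target -/

section Approximation

variable {E : Type*} [NormedAddCommGroup E] [InnerProductSpace ℝ E]
  {X : Type*} [TopologicalSpace X] [ChartedSpace E X]
  {EM : Type*} [NormedAddCommGroup EM] [NormedSpace ℝ EM] [FiniteDimensional ℝ EM]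
  {HM : Type*} [TopologicalSpace HM] {IM : ModelWithCorners ℝ EM HM}
  {M : Type*} [TopologicalSpace M] [ChartedSpace HM M] [IsManifold IM ∞ M]
  [CompactSpace M] [T2Space M]

omit [CompactSpace M] [T2Space M] in
/-- A cut-off of a map which is continuous on an open set: `β' • F`, with `tsupport β' ⊆ W` and
`F` continuous on the open `W`, is continuous (it vanishes near every point off `tsupport β'`).
[folklore] -/
theorem continuous_cutoff_smul {W : Set M} (hW : IsOpen W) {F : M → E} (hF : ContinuousOn F W)
    {β' : M → ℝ} (hβ' : Continuous β') (hsupp : tsupport β' ⊆ W) :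
    Continuous fun x => β' x • F x := by
  refine continuous_iff_continuousAt.2 fun x => ?_
  by_cases hx : x ∈ W
  · exact ((hβ'.continuousOn.smul hF).continuousAt (hW.mem_nhds hx))
  · have hxs : x ∉ tsupport β' := fun h => hx (hsupp h)
    have h0 : (fun y => β' y • F y) =ᶠ[𝓝 x] fun _ => 0 := by
      filter_upwards [notMem_tsupport_iff_eventuallyEq.1 hxs] with y hy
      simp only [hy, Pi.zero_apply, zero_smul]
    exact (continuousAt_const.congr h0.symm)

omit [FiniteDimensional ℝ EM] [IsManifold IM ∞ M] [CompactSpace M] [T2Space M] in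
/-- The same cut-off is `C^∞` wherever `F` is. [folklore] -/
theorem contMDiffOn_cutoff_smul {W O : Set M} (hW : IsOpen W) (hO : IsOpen O) {F : M → E}
    (hF : ContMDiffOn IM 𝓘(ℝ, E) ∞ F (O ∩ W)) {β' : M → ℝ} (hβ' : ContMDiff IM 𝓘(ℝ) ∞ β')
    (hsupp : tsupport β' ⊆ W) : ContMDiffOn IM 𝓘(ℝ, E) ∞ (fun x => β' x • F x) O := by
  intro x hx
  by_cases hxW : x ∈ W
  · have h1 : ContMDiffOn IM 𝓘(ℝ, E) ∞ (fun y => β' y • F y) (O ∩ W) :=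
      hβ'.contMDiffOn.smul hF
    exact (h1.contMDiffAt ((hO.inter hW).mem_nhds ⟨hx, hxW⟩)).contMDiffWithinAt
  · have hxs : x ∉ tsupport β' := fun h => hxW (hsupp h)
    have h0 : (fun y => β' y • F y) =ᶠ[𝓝 x] fun _ => 0 := by
      filter_upwards [notMem_tsupport_iff_eventuallyEq.1 hxs] with y hy
      simp only [hy, Pi.zero_apply, zero_smul]
    exact (contMDiffAt_const.congr_of_eventuallyEq h0).contMDiffWithinAt

/-- **One smoothing move** (Milnor 1965, Lemma 6.11; Hirsch 1976, Ch. 2 Thm. 2.6 — one chart of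
the target).  Let `g : M → X` be continuous, `C^∞` on the open `O ⊇ B`; let `c` be a full chart
of `X` and `β` a smooth weight with `tsupport β ⊆ g ⁻¹' U`, equal to `1` near the points of `K`;
and let `g` map finitely many compact `C i` into open `V i`.  Then some chart move `g'` of `g`
(hence homotopic to it) is `C^∞` on an open set containing `B ∪ K` and still maps each `C i`
into `V i`.  The displacement is `s - β' • (ψ ∘ g)` with `β'` a cut-off equal to `1` near
`tsupport β` and `s` a uniformly close smooth approximation of `β' • (ψ ∘ g)`
(`Continuous.exists_contMDiff_approx`); where `β = 1` the move is `χ ∘ s`.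
[cite: MilnorHCobordism1965, Lemma 6.11] -/
theorem FullChart.exists_move_contMDiffOn (c : FullChart E X) {g : M → X} (hg : Continuous g)
    {O : Set M} (hO : IsOpen O) (hgO : ContMDiffOn IM 𝓘(ℝ, E) ∞ g O) {B : Set M} (hBO : B ⊆ O)
    {β : M → ℝ} (hβ : ContMDiff IM 𝓘(ℝ) ∞ β) (hsupp : tsupport β ⊆ g ⁻¹' c.1.source) {K : Set M}
    (hK : ∀ x ∈ K, β =ᶠ[𝓝 x] fun _ => 1) {ι : Type*} [Finite ι] {C : ι → Set M} {V : ι → Set X}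
    (hC : ∀ i, IsCompact (C i)) (hV : ∀ i, IsOpen (V i)) (hCV : ∀ i, MapsTo g (C i) (V i)) :
    ∃ P : C(M, E), (∃ O' : Set M, IsOpen O' ∧ B ∪ K ⊆ O' ∧
        ContMDiffOn IM 𝓘(ℝ, E) ∞ (c.move g β P) O') ∧ ∀ i, MapsTo (c.move g β P) (C i) (V i) := by
  have hWo : IsOpen (g ⁻¹' c.1.source) := c.1.open_source.preimage hg
  -- ### the cut-off `β'`
  obtain ⟨L, hLc, hβL, hLW⟩ := exists_compact_between (isClosed_tsupport β).isCompact hWo hsupp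
  obtain ⟨β', hβ'1, hβ'0, hβ'01⟩ := exists_contMDiffMap_one_nhds_of_subset_interior IM
    (isClosed_tsupport β) hβL (n := (⊤ : ℕ∞))
  have hβ's : tsupport β' ⊆ g ⁻¹' c.1.source := by
    refine (closure_minimal (fun x hx => ?_) hLc.isClosed).trans hLW
    by_contra h
    exact hx (hβ'0 x h)
  have hβ'c : ContMDiff IM 𝓘(ℝ) ∞ β' := β'.contMDiff
  have hβ'β : ∀ x ∈ tsupport β, β' x = 1 := fun x hx => hβ'1.self_of_nhdsSet x hx
  -- ### the cut-off coordinate function `G = β' • (ψ ∘ g)` and its approximation `s`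
  set G : M → E := fun x => β' x • c.1 (g x) with hG
  have hGc : Continuous G :=
    continuous_cutoff_smul hWo (c.1.continuousOn.comp hg.continuousOn fun x hx => hx)
      hβ'c.continuous hβ's
  have hGO : ContMDiffOn IM 𝓘(ℝ, E) ∞ G (O ∩ g ⁻¹' c.1.source) := by
    refine contMDiffOn_cutoff_smul hWo (hO.inter hWo) ?_ hβ'c hβ's
    rw [inter_assoc, inter_self]
    exact c.2.contMDiffOn.comp (hgO.mono inter_subset_left) fun x hx => hx.2
  obtain ⟨δ, hδ, hδP⟩ := c.exists_pos_forall_mapsTo_move hg hβ.continuous hsupp hC hV hCV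
  obtain ⟨s, hs, -⟩ := hGc.exists_contMDiff_approx IM ⊤ continuous_const (fun _ => half_pos hδ)
  -- ### the displacement `P = s - G`
  set P : C(M, E) := ⟨fun x => s x - G x, s.contMDiff.continuous.sub hGc⟩ with hP
  have hPn : ‖P‖ < δ := by
    rcases isEmpty_or_nonempty M with hM | hM
    · have : P = 0 := by ext x; exact (IsEmpty.false x).elim
      rw [this, norm_zero]; exact hδ
    refine (ContinuousMap.norm_lt_iff P hδ).2 fun x => ?_
    show ‖s x - G x‖ < δ
    rw [← dist_eq_norm]
    exact (hs x).trans (half_lt_self hδ)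
  refine ⟨P, ?_, hδP P hPn⟩
  -- ### smoothness on an open set containing `B ∪ K`
  set O₁ : Set M := O ∩ (tsupport β)ᶜ with hO₁
  set O₂ : Set M := O ∩ g ⁻¹' c.1.source with hO₂
  set O₃ : Set M := {x | β =ᶠ[𝓝 x] fun _ => 1} with hO₃
  have hO₁o : IsOpen O₁ := hO.inter (isClosed_tsupport β).isOpen_compl
  have hO₂o : IsOpen O₂ := hO.inter hWo
  have hO₃o : IsOpen O₃ := by
    show IsOpen {x | ∀ᶠ y in 𝓝 x, β y = (fun _ => (1 : ℝ)) y}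
    exact isOpen_setOf_eventually_nhds
  refine ⟨O₁ ∪ O₂ ∪ O₃, (hO₁o.union hO₂o).union hO₃o, ?_, ?_⟩
  · rintro x (hx | hx)
    · by_cases h : x ∈ tsupport β
      · exact Or.inl (Or.inr ⟨hBO hx, hsupp h⟩)
      · exact Or.inl (Or.inl ⟨hBO hx, h⟩)
    · exact Or.inr (hK x hx)
  -- on `O₂` the move is the displayed composite
  have h2 : ContMDiffOn IM 𝓘(ℝ, E) ∞ (c.move g β P) O₂ :=
    c.contMDiffOn_move hO₂o hg (hgO.mono inter_subset_left) hβ hsupp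
      ((s.contMDiff.contMDiffOn).sub hGO)
  -- on `O₃` (where `β = 1` near the point) the move is `χ ∘ s`
  have h3 : ∀ x ∈ O₃, (c.move g β P) =ᶠ[𝓝 x] fun y => c.1.symm (s y) := by
    intro x hx
    have hx' : ∀ᶠ y in 𝓝 x, β =ᶠ[𝓝 y] fun _ => 1 := by
      have : IsOpen O₃ := hO₃o
      exact this.mem_nhds hx
    filter_upwards [hx'] with y hy
    have hβy : β y = 1 := hy.self_of_nhds
    have hyt : y ∈ tsupport β := subset_tsupport _ (by simp [hβy])
    have hyU : g y ∈ c.1.source := hsupp hyt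
    rw [FullChart.move_of_mem hyU, hβy, one_smul]
    show c.1.symm (c.1 (g y) + (s y - β' y • c.1 (g y))) = c.1.symm (s y)
    rw [hβ'β y hyt, one_smul, add_sub_cancel]
  intro x hx
  rcases hx with (hx | hx) | hx
  · -- `O₁`: the move is `g`
    have hg1 : ContMDiffAt IM 𝓘(ℝ, E) ∞ g x := hgO.contMDiffAt (hO.mem_nhds hx.1)
    exact (hg1.congr_of_eventuallyEq
      (FullChart.move_eventuallyEq_of_notMem_tsupport hx.2 _)).contMDiffWithinAt
  · exact (h2.contMDiffAt (hO₂o.mem_nhds hx)).contMDiffWithinAt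
  · have h1 : ContMDiffAt IM 𝓘(ℝ, E) ∞ (fun y => c.1.symm (s y)) x :=
      (c.2.contMDiff_symm.comp s.contMDiff).contMDiffAt
    exact (h1.congr_of_eventuallyEq (h3 x hx)).contMDiffWithinAt

/-- **Whitney approximation in a homotopy class, for a non-compact target** (Hirsch,
*Differential Topology* (1976), Ch. 2 §2 Thm. 2.6; Lee, *Introduction to Smooth Manifolds*
(2013), Thm. 6.26; Milnor (1965), Lemma 6.11): every continuous map from a compact Hausdorff
`C^∞` manifold `M` (finite-dimensional model with corners) into a `C^∞` manifold `X` charted on a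
finite-dimensional inner product space (not necessarily compact) is homotopic to a `C^∞` map.
Proof: finitely many smoothing moves (`FullChart.exists_move_contMDiffOn`) over a cover of `M` by
plateaus of bump functions supported in preimages of full charts, the chart conditions of the
later moves being carried along as compact-into-open constraints; each move is homotopic to the
previous map (`FullChart.homotopic_move`). [cite: HirschDT1976, Ch. 2 §2 Thm. 2.6] -/
theorem exists_contMDiff_homotopic_of_chartMoves [IsManifold 𝓘(ℝ, E) ∞ X] (f : C(M, X)) :
    ∃ g : C(M, X), ContMDiff IM 𝓘(ℝ, E) ∞ g ∧ f.Homotopic g := by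
  classical
  -- ### full charts, plateaus and bumps
  have hdata : ∀ x : M, ∃ (c : FullChart E X) (K : Set M) (β : C^∞⟮IM, M; 𝓘(ℝ), ℝ⟯),
      IsCompact K ∧ K ∈ 𝓝 x ∧ (∀ y ∈ K, (β : M → ℝ) =ᶠ[𝓝 y] fun _ => 1) ∧
        tsupport β ⊆ f ⁻¹' c.1.source := by
    intro x
    obtain ⟨c, hxc⟩ := exists_fullChart (E := E) (f x)
    have hWo : IsOpen (f ⁻¹' c.1.source) := c.1.open_source.preimage f.continuous
    obtain ⟨K, hKc, hxK, hKW⟩ := exists_compact_between isCompact_singleton hWo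
      (singleton_subset_iff.2 hxc)
    obtain ⟨L, hLc, hKL, hLW⟩ := exists_compact_between hKc hWo hKW
    obtain ⟨β, hβ1, hβ0, -⟩ := exists_contMDiffMap_one_nhds_of_subset_interior IM hKc.isClosed hKL
      (n := (⊤ : ℕ∞))
    refine ⟨c, K, β, hKc, mem_interior_iff_mem_nhds.1 (hxK rfl), fun y hy => ?_, ?_⟩
    · have : ∀ᶠ z in 𝓝ˢ K, (β : M → ℝ) z = 1 := hβ1
      exact (this.filter_mono (nhds_le_nhdsSet hy) : ∀ᶠ z in 𝓝 y, (β : M → ℝ) z = 1)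
    · refine (closure_minimal (fun y hy => ?_) hLc.isClosed).trans hLW
      by_contra h
      exact hy (hβ0 y h)
  choose c K β hKc hKn hK1 hβs using hdata
  obtain ⟨t, -, htK⟩ := isCompact_univ.elim_nhds_subcover K fun x _ => hKn x
  -- ### induction over the pieces
  have key : ∀ S : Finset M, S ⊆ t → ∃ g : C(M, X), f.Homotopic g ∧
      (∃ O : Set M, IsOpen O ∧ (⋃ x ∈ S, K x) ⊆ O ∧ ContMDiffOn IM 𝓘(ℝ, E) ∞ g O) ∧
        ∀ x : (t : Set M), MapsTo g (tsupport (β x)) (c x).1.source := by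
    intro S
    induction S using Finset.induction_on with
    | empty =>
      intro _
      exact ⟨f, ContinuousMap.Homotopic.refl f, ⟨∅, isOpen_empty, by simp, contMDiffOn_empty⟩,
        fun x y hy => hβs x hy⟩
    | insert a S haS ih =>
      intro hS
      obtain ⟨g, hfg, ⟨O, hOo, hKO, hgO⟩, hmaps⟩ := ih ((Finset.subset_insert a S).trans hS)
      have hat : a ∈ t := hS (Finset.mem_insert_self a S)
      have hsupp : tsupport (β a) ⊆ g ⁻¹' (c a).1.source := hmaps ⟨a, hat⟩
      obtain ⟨P, ⟨O', hO'o, hKO', hgO'⟩, hmaps'⟩ :=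
        (c a).exists_move_contMDiffOn (IM := IM) g.continuous hOo hgO hKO (β a).contMDiff hsupp
          (hK1 a) (ι := (t : Set M)) (C := fun x => tsupport (β x)) (V := fun x => (c x).1.source)
          (fun x => (isClosed_tsupport _).isCompact) (fun x => (c x).1.open_source) hmaps
      refine ⟨(c a).moveFamily g.continuous (β a).contMDiff.continuous hsupp P,
        hfg.trans ((c a).homotopic_move g.continuous (β a).contMDiff.continuous hsupp P),
        ⟨O', hO'o, ?_, hgO'⟩, hmaps'⟩
      intro y hy
      simp only [Finset.mem_insert, mem_iUnion, exists_prop] at hy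
      obtain ⟨x, rfl | hx, hyx⟩ := hy
      · exact hKO' (Or.inr hyx)
      · exact hKO' (Or.inl (mem_iUnion₂.2 ⟨x, hx, hyx⟩))
  obtain ⟨g, hfg, ⟨O, hOo, hKO, hgO⟩, -⟩ := key t Finset.Subset.rfl
  refine ⟨g, fun x => ?_, hfg⟩
  have hx : x ∈ O := by
    have := htK (mem_univ x)
    simp only [mem_iUnion, exists_prop] at this
    obtain ⟨y, hy, hxy⟩ := this
    exact hKO (mem_iUnion₂.2 ⟨y, hy, hxy⟩)
  exact hgO.contMDiffAt (hOo.mem_nhds hx)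

end Approximation

end Literature.Topology.FourManifolds
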